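import Summits.QuantumFields.YangMills.Theorems.BalabanUVNodesN12DirectSurjSharpDelta2
import Literature.MathematicalPhysics.QuantumFieldTheory.Balaban1983to89.Node00.MultiScaleFibreChartB
import Literature.MathematicalPhysics.QuantumFieldTheory.Balaban1983to89.Node00.MultiScaleFibreChartCurvatureUniformB
import Literature.MathematicalPhysics.QuantumFieldTheory.Balaban1983to89.Node00.MultiScaleFibreChartLagrangeB
import Summits.QuantumFields.YangMills.Theorems.BalabanUVNodesN07LinearisedAveragingKernelB
import Summits.QuantumFields.YangMills.Theorems.BalabanUVNodesN12NearFlatDelta2LetterB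
import HarnessLib

/-!
# DAG node N12 [B15] — (P4)′ road, step (T3♯): THE LETTER (δ₂) PER COMPONENT WITH NEAR-FLATNESS ON THE SHARP TOWER ONLY, AND PER-COMPONENT GAUGE COVARIANCE — **BOND-DATUM EDITION** (`…N12DirectSurjSharpDelta2B`, USED DECLARATIONS ONLY)

The print-datum ([Balaban1984PropagatorsII] (2.3)) (γ) twin of `Summits/…/Theorems/BalabanUVNodesN12DirectSurjSharpDelta2.lean`: the declarations of the parent whose STATEMENT reads the determining datum
(`exists_delta2_letter_component_sharp`, `fderiv_msChart_gaugeAct_apply`, `msChart_apply_eq_of_eqOn_sharp_of_fibre`) and which N12's junction of record v14ᴸ uses (dag-n12-c g35 probe-2 census `UsedConstsN12RoadTyped2`, THEOREMS block), re-typed over a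
BOND-LEVEL datum `𝔅 : BDetSet` (F0a `B15DeterminingSetsB`) and dag-n12-c's bond-datum chart `Node00.msChartB` (✓p774329; `msChart 𝐁 = msChartB (bondsDet 𝐁)` by `rfl`).  GENERATOR twin
(this seat's `work/g32/gen_thm.py`, block-extracted from the parent's tree bytes): namespace `…N12DirectSurjSharpDelta2B`, SAME short names, `DetSet ↦ BDetSet`, `AgreeOn 𝐁 ↦ AgreeOnB 𝔅`,
`IsMinimizer ↦ IsMinimizerB`, `bondsOf (𝐁 j) ↦ 𝔅 j`, `msChart ∕ constrCard ∕ constrEnum ∕ ConstrSet ↦ …B`, NODE 00 chart lemmas `…msChart… ↦ …msChartB…`; proofs VERBATIM; the parent's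
datum-free declarations REUSED BY NAME (`open`), never copied (private plumbing excepted, №366 R2).  The parent's (b) statements are the instances `𝔅 := bondsDet 𝐁`.

Cell `pub-ymgap` (HUMAN RULINGS D-0062 ∕ D-0149), seat `pub-ymgap-dag-n12-d` g32 (R134 N12 [B15] s2; the (ii) Theorems-side re-key of N12's road at print's [II] (2.3) datum — director-ym №338 ∕
№343 (E1)(iii-b), FLAG №16 ∕ ruling (α); dag-n12-c DESIGN memo a793b2ebc0b803bf (ii); `N12-ROAD-TWIN-ORDER-2026-08-30.md`).  Count-neutral helper of K1⁹ `stmt-QuantumFields-27364`,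
`--kind proof --supports … --as helper`.  THEOREMS ONLY (0 `def`, 0 `instance`, 0 `sorry`).

HONEST FRAMING (director-ym №338 (5)).  PURELY ADDITIVE: the parent stays landed and true on its own text; nothing in it is edited; no displayed premise of any consumer is deleted or
weakened; every hypothesis of the parent stays a hypothesis.  Nothing of Bałaban's analysis asserted; N12 NOT discharged; K0⁷ ∕ K1⁹ NOT closed; counts unmoved (typed 28∕28 · discharged
8∕27, A 8∕28; K 1∕4); one finite 𝕋⁴ programme at fixed ε — R4 closes the conditional rung `BalabanLadder.UV` only; NOT the Yang–Mills mass gap (Clay); nothing continuum ∕ ℝ⁴ ∕ OS.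

PARENT's DOCSTRING (the mathematics and the citations; read the site-level `𝐁` as the bond datum `𝔅`):
# DAG node N12 [B15] — (P4)′ road, step (T3♯): THE LETTER (δ₂) PER COMPONENT WITH NEAR-FLATNESS ON THE SHARP TOWER ONLY, AND PER-COMPONENT GAUGE COVARIANCE

Cell `pub-ymgap` (HUMAN RULINGS D-0062 ∕ D-0149), width seat `pub-ymgap-dag-n12-w6` g6 = the N12 (P4) clone by row (director-ym R463-ym; target = dag-n12-c's (P4)′ socket
of record, INBOX l.42120).  Key K1⁹ `stmt-QuantumFields-27364`, `--kind proof --supports … --as helper`; count-neutral; THEOREMS ONLY (0 `def`, 0 `sorry`).  Design note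
`HOME/pub-ymgap-dag-n12-w6/P4-DESIGN.md`.  (First half of the announced `…N12DirectSurjSiteBlockCurved`, split for the 400-line lint.)

WHY.  dag-n12-w4's `exists_delta2_letter_component` (p648433) asks near-flatness on `feeds j c` — the window of the abstract locality axiom, which at the `j`-th iterate spills
one block beyond the two-block tower in the positive directions; for the (P4)′ road every row is flattened by ONE axial gauge of the `3^d`-block box around an inner `j`-site,
which [III] (2.13)'s collar places inside `Ω_{j−1}` but NOT the spilled block when `M₁ = 2`.  Bałaban's (0.4) is TWO-BLOCK LOCAL (pv11's
`T4ReflectionConeSharp.twoBlockLocal_blockAvg`); this file iterates that property and re-derives (δ₂) per component under near-flatness on the sharp tower only, then records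
the per-component gauge covariance of the chart derivative (the `Ad`-twist by which a curved row is compared with the flat row after a local gauge).

CONTENTS.  §1 ★ `iter_congr_of_twoBlockLocal`, `avgFamily_congr_sharp`.  §2 ★ `msChart_apply_eq_of_eqOn_sharp_of_fibre`.  §3 ★★★ `exists_delta2_letter_component_sharp` (ONE `C, ρ` per
height; the (δ₂) row `i` under `δ`-near-flatness on the sharp tower of `i` only), `exists_delta2_letter_component_sharp_Bj`.  §4 ★★ `fderiv_msChart_gaugeAct_apply`
(`(DΨ_{W^u,U₀^u}(0)(Ad_{u(b₊)}X))_i = Ad_{ū_j(c₊)} (DΨ_{W,U₀}(0)X)_i`).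

HONEST FRAMING.  Composition by name over landed kernel theorems; per-height existence constants (NOT print's volume-uniform `O(1)`); nothing of Bałaban's asserted; N12 NOT
discharged; K1⁹ NOT closed; count-neutral (typed 28∕28 · discharged 5∕27 unmoved); R4 closes only the conditional finite-`𝕋⁴` rung `BalabanLadder.UV`; the YM mass gap (Clay)
is NOT proved by any of this.
-/

noncomputable section

open scoped BigOperators Matrix.Norms.L2Operator Topology
open Filter Finset

namespace Summit.QuantumFields.YangMills.BalabanUVNodes.N12DirectSurjSharpDelta2B

open Literature.MathematicalPhysics.QuantumFieldTheory.Balaban1983to89.B15DeterminingSetsB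

open Literature.MathematicalPhysics.QuantumFieldTheory.Balaban1983to89
open T4Continuum (T4Family)
open T4ReflectionConeSharp (TwoBlockLocal twoBlockLocal_blockAvg)
open BlockAveragingEMLLinearised (linAvg)
open T4AdjointCovarianceUnitary (lieSU)
open B15DeterminingSets
open B14.Eq213DetSet (Bj)
open B5Eq118OneStroke (iterBlockOf iterBlockOf_zero iterBlockOf_succ)
open Node00
open Literature.MathematicalPhysics.QuantumFieldTheory.Balaban1983to89.Node00 (qLin_gaugeAct_avOfRecord smallBelow_gaugeAct)
open Summit.QuantumFields.YangMills.BalabanUVNodes.N12NearFlatDelta2Letter (exists_guard_of_nearFlat)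
open Summit.QuantumFields.YangMills.BalabanUVNodes.N12NearFlatDelta2LetterB (exists_delta2_letter)
open Summit.QuantumFields.YangMills.BalabanUVNodes.N12NearFlatDelta2LetterComponent (fderiv_apply_eq_fderiv_component)
open Summit.QuantumFields.YangMills.BalabanUVNodes.N12DirectSurjSharpDelta2 (avgFamily_congr_sharp)

section
variable {F : T4Family} {N : ℕ} [NeZero N] {K k : ℕ}

/-- ★ **SHARP COMPONENT IDENTITY**: if `U′ = U₀` on the fine bonds with both end-points in `B^{j_i}(c_{i,−}) ∪ B^{j_i}(c_{i,+})` and `W` is `U₀`'s fibre label on `𝐁`, then for EVERY `X`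
`Ψ_{𝐁,W,U₀}(X)_i = Ψ_{𝐁,M˙U′,U′}(X)_i`. [cite: Balaban1988Convergent, (2.10)–(2.11) p.256; Balaban1985Variational, (47) p.285] -/
theorem msChart_apply_eq_of_eqOn_sharp_of_fibre (hk : k ≤ (F.P K).m + (F.P K).K) {𝔅 : BDetSet (F.P K)} {W : MSField (F.P K) (SU N)}
    {U₀ U' : GaugeField (F.P K) 0 (SU N)} (hU : AgreeOnB 𝔅 (avgFamily (avOfRecord F N K) U₀) W) (i : Fin (constrCardB 𝔅 k))
    (hin : ∀ b₀ : PBond (F.P K) 0,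
      (iterBlockOf (((constrEnumB 𝔅 k).symm i).1 : ℕ) b₀.src = ((constrEnumB 𝔅 k).symm i).2.1.src ∨
        iterBlockOf (((constrEnumB 𝔅 k).symm i).1 : ℕ) b₀.src = ((constrEnumB 𝔅 k).symm i).2.1.tgt) →
      (iterBlockOf (((constrEnumB 𝔅 k).symm i).1 : ℕ) b₀.tgt = ((constrEnumB 𝔅 k).symm i).2.1.src ∨
        iterBlockOf (((constrEnumB 𝔅 k).symm i).1 : ℕ) b₀.tgt = ((constrEnumB 𝔅 k).symm i).2.1.tgt) → U' b₀ = U₀ b₀)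
    (X : PBond (F.P K) 0 → lieSU (Fin N)) :
    msChartB F N K k 𝔅 W U₀ X i = msChartB F N K k 𝔅 (avgFamily (avOfRecord F N K) U') U' X i := by
  have hj : (((constrEnumB 𝔅 k).symm i).1 : ℕ) ≤ (F.P K).m + (F.P K).K := (Nat.le_of_lt_succ ((constrEnumB 𝔅 k).symm i).1.2).trans hk
  have hW : W (((constrEnumB 𝔅 k).symm i).1 : ℕ) ((constrEnumB 𝔅 k).symm i).2.1
      = avgFamily (avOfRecord F N K) U' (((constrEnumB 𝔅 k).symm i).1 : ℕ) ((constrEnumB 𝔅 k).symm i).2.1 := by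
    rw [← hU _ _ ((constrEnumB 𝔅 k).symm i).2.2]
    exact avgFamily_congr_sharp hj _ fun b hs ht => (hin b hs ht).symm
  have hav : avgFamily (avOfRecord F N K) (expChart U₀ X) (((constrEnumB 𝔅 k).symm i).1 : ℕ) ((constrEnumB 𝔅 k).symm i).2.1
      = avgFamily (avOfRecord F N K) (expChart U' X) (((constrEnumB 𝔅 k).symm i).1 : ℕ) ((constrEnumB 𝔅 k).symm i).2.1 :=
    avgFamily_congr_sharp hj _ fun b hs ht => by
      show U₀ b * _ = U' b * _
      rw [hin b hs ht]
  rw [msChartB_apply, msChartB_apply, relAvg, relAvg, hW, hav]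

end

section
variable {F : T4Family} {N : ℕ} [NeZero N] {K k : ℕ}

/-- ★★★ **THE LETTER (δ₂), SHARP COMPONENT EDITION** — ONE `C ≥ 0` and ONE `ρ > 0` per height: for every determining set `𝐁` with no member above `k ≤ m + K`, every datum `W`, every `U₀` IN
THE FIBRE with `Ψ_{𝐁,W,U₀}` differentiable at `0`, every constrained index `i ↔ (j, c)` and every `0 ≤ δ < ρ` with `‖↑U₀_b − 1‖ ≤ δ` on the fine bonds `b` with BOTH END-POINTS in
`B^j(c₋) ∪ B^j(c₊)`: `‖(DΨ_{𝐁,W,U₀}(0)w)_i − (DΨ_{𝐁,M˙1,1}(0)w)_i‖ ≤ C·δ·p(w)` for every `w`. [cite: Balaban1989LargeFieldII, p.357, (1.12)–(1.13) p.359; Balaban1988Convergent, (2.11)–(2.13) pp.256–257; Balaban1985Variational, (47) p.285, (81)–(83) p.290; Balaban1987RG1, (0.4) p.253] -/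
theorem exists_delta2_letter_component_sharp (k : ℕ)
    (Q : (i : ℕ) → (PBond (F.P K) 0 → Matrix (Fin N) (Fin N) ℂ) → PBond (F.P K) i → Matrix (Fin N) (Fin N) ℂ)
    (hQ0 : ∀ Y, Q 0 Y = Y) (hQs : ∀ (i : ℕ) (Y : PBond (F.P K) 0 → Matrix (Fin N) (Fin N) ℂ) (c : PBond (F.P K) (i + 1)), Q (i + 1) Y c = linAvg (Q i Y) c)
    (p : Seminorm ℝ (PBond (F.P K) 0 → lieSU (Fin N)))
    (hp : ∀ Y : PBond (F.P K) 0 → lieSU (Fin N), ∑ b, ‖(Y b : Matrix (Fin N) (Fin N) ℂ)‖ ^ 2 ≤ p Y ^ 2) :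
    ∃ C ρ : ℝ, 0 ≤ C ∧ 0 < ρ ∧
      ∀ (𝔅 : BDetSet (F.P K)) (W : MSField (F.P K) (SU N)) (U₀ : GaugeField (F.P K) 0 (SU N)),
        (∀ j, k < j → 𝔅 j = ∅) → k ≤ (F.P K).m + (F.P K).K →
        AgreeOnB 𝔅 (avgFamily (avOfRecord F N K) U₀) W → DifferentiableAt ℝ (msChartB F N K k 𝔅 W U₀) 0 →
        ∀ (i : Fin (constrCardB 𝔅 k)) ⦃δ : ℝ⦄, 0 ≤ δ → δ < ρ →
        (∀ b₀ : PBond (F.P K) 0,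
          (iterBlockOf (((constrEnumB 𝔅 k).symm i).1 : ℕ) b₀.src = ((constrEnumB 𝔅 k).symm i).2.1.src ∨
            iterBlockOf (((constrEnumB 𝔅 k).symm i).1 : ℕ) b₀.src = ((constrEnumB 𝔅 k).symm i).2.1.tgt) →
          (iterBlockOf (((constrEnumB 𝔅 k).symm i).1 : ℕ) b₀.tgt = ((constrEnumB 𝔅 k).symm i).2.1.src ∨
            iterBlockOf (((constrEnumB 𝔅 k).symm i).1 : ℕ) b₀.tgt = ((constrEnumB 𝔅 k).symm i).2.1.tgt) →
          ‖((U₀ b₀ : SU N) : Matrix (Fin N) (Fin N) ℂ) - 1‖ ≤ δ) →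
        ∀ w : PBond (F.P K) 0 → lieSU (Fin N),
          ‖fderiv ℝ (msChartB F N K k 𝔅 W U₀) 0 w i
              - fderiv ℝ (msChartB F N K k 𝔅 (avgFamily (avOfRecord F N K) (1 : GaugeField (F.P K) 0 (SU N))) (1 : GaugeField (F.P K) 0 (SU N))) 0 w i‖
            ≤ C * δ * p w := by
  obtain ⟨C, ρ₁, hC, hρ₁, h⟩ := exists_delta2_letter (F := F) (N := N) (K := K) k Q hQ0 hQs p hp
  obtain ⟨t₀, ρg, ht₀, hst, hρg, hguard⟩ := exists_guard_of_nearFlat (F := F) (N := N) K k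
  obtain ⟨_, ρ'', _, hρ'', hsb, _⟩ := exists_uniform_chartCurvatureB_sq_bound (F := F) (N := N) (K := K) k
  refine ⟨C, min ρ₁ (min ρg ρ''), hC, lt_min hρ₁ (lt_min hρg hρ''), fun 𝔅 W U₀ _ hk hU hΨ i δ hδ0 hδρ hloc w => ?_⟩
  -- the proxy: `U₀` on the sharp tower, `1` elsewhere
  let S : Set (PBond (F.P K) 0) := {b₀ |
    (iterBlockOf (((constrEnumB 𝔅 k).symm i).1 : ℕ) b₀.src = ((constrEnumB 𝔅 k).symm i).2.1.src ∨
      iterBlockOf (((constrEnumB 𝔅 k).symm i).1 : ℕ) b₀.src = ((constrEnumB 𝔅 k).symm i).2.1.tgt) ∧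
    (iterBlockOf (((constrEnumB 𝔅 k).symm i).1 : ℕ) b₀.tgt = ((constrEnumB 𝔅 k).symm i).2.1.src ∨
      iterBlockOf (((constrEnumB 𝔅 k).symm i).1 : ℕ) b₀.tgt = ((constrEnumB 𝔅 k).symm i).2.1.tgt)}
  obtain ⟨U', hin, hflat⟩ := Node00.exists_nearFlat_eqOn U₀ S hδ0 fun b hb => hloc b hb.1 hb.2
  have hρ1 : δ < ρ₁ := lt_of_lt_of_le hδρ (min_le_left _ _)
  have hρ2 : δ ≤ ρg := (le_of_lt hδρ).trans ((min_le_right _ _).trans (min_le_left _ _))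
  have hρ3 : δ ≤ ρ'' := (le_of_lt hδρ).trans ((min_le_right _ _).trans (min_le_right _ _))
  have hg : ∀ i', i' < k → PlaqSmall t₀ (Averaging.iter (avOfRecord F N K) i' U') := fun i' hi' => hguard U' (hflat.trans hρ2) i' hi'.le
  have hlt : ‖coeField U' - 1‖ < ρ₁ := lt_of_le_of_lt hflat hρ1
  have hAgr : AgreeOnB 𝔅 (avgFamily (avOfRecord F N K) U') (avgFamily (avOfRecord F N K) U') := fun _ _ _ => rfl
  -- the global letter at the proxy in its own fibre
  have key := h ht₀ hst U' 𝔅 (avgFamily (avOfRecord F N K) U') hg hlt hAgr w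
  have keyi : ‖fderiv ℝ (msChartB F N K k 𝔅 (avgFamily (avOfRecord F N K) U') U') 0 w i
      - fderiv ℝ (msChartB F N K k 𝔅 (avgFamily (avOfRecord F N K) (1 : GaugeField (F.P K) 0 (SU N))) (1 : GaugeField (F.P K) 0 (SU N))) 0 w i‖ ≤ C * δ * p w := by
    rw [← Pi.sub_apply]
    exact (norm_le_pi_norm _ i).trans (key.trans (mul_le_mul_of_nonneg_right (mul_le_mul_of_nonneg_left hflat hC) (apply_nonneg p w)))
  -- the sharp component identity `(DΨ_{W,U₀}(0)w)_i = (DΨ_{M˙U′,U′}(0)w)_i`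
  have hΨ' : DifferentiableAt ℝ (msChartB F N K k 𝔅 (avgFamily (avOfRecord F N K) U') U') 0 := differentiableAt_msChartB hAgr (hsb U' (hflat.trans hρ3))
  have hfun : (fun X => msChartB F N K k 𝔅 W U₀ X i) = fun X => msChartB F N K k 𝔅 (avgFamily (avOfRecord F N K) U') U' X i :=
    funext fun X => msChart_apply_eq_of_eqOn_sharp_of_fibre hk hU i (fun b hs ht => hin b ⟨hs, ht⟩) X
  have hcomp : fderiv ℝ (msChartB F N K k 𝔅 W U₀) 0 w i = fderiv ℝ (msChartB F N K k 𝔅 (avgFamily (avOfRecord F N K) U') U') 0 w i := by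
    rw [fderiv_apply_eq_fderiv_component hΨ, fderiv_apply_eq_fderiv_component hΨ', hfun]
  rw [hcomp]
  exact keyi

end

section
variable {F : T4Family} {N : ℕ} [NeZero N] {K k : ℕ}

/-- ★ **GAUGE COVARIANCE OF THE CHART DERIVATIVE, COMPONENT BY COMPONENT.**  For a fine gauge transformation `u`, `U₀` in the fibre of `W` on `𝐁` (no member above `k ≤ m + K`) with the guard
below `k`: the chart at the transformed pair (`U₀^u`, `W^u := (u↾_j)(c₋)·W_j(c)·(u↾_j)(c₊)⁻¹`) applied to the transformed direction `b ↦ Ad(u(b₊))X_b` has `i`-th component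
`Ad((u↾_{j_i})(c_{i,+}))` of the `i`-th component of `DΨ_{𝐁,W,U₀}(0)X` (n07-w1's `qLin_gaugeAct` read through `coe_fderiv_msChart_apply_eq_qLin`).
[cite: Balaban1985Variational, (153) p.301, (44)-(47) p.285; Balaban1985Averaging, (11) p.19; Balaban1989LargeFieldII, (1.25) p.362] -/
theorem fderiv_msChart_gaugeAct_apply {𝔅 : BDetSet (F.P K)} (h𝔅 : ∀ j, k < j → 𝔅 j = ∅) (hk : k ≤ (F.P K).m + (F.P K).K) (u : GaugeTransf (F.P K) 0 (SU N))
    {W : MSField (F.P K) (SU N)} {U₀ : GaugeField (F.P K) 0 (SU N)} (hU : AgreeOnB 𝔅 (avgFamily (avOfRecord F N K) U₀) W) (hsb : SmallBelow (avOfRecord F N K) k U₀)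
    (X : PBond (F.P K) 0 → lieSU (Fin N)) (i : Fin (constrCardB 𝔅 k)) :
    fderiv ℝ (msChartB F N K k 𝔅 (fun j c => B16Sect1Backgrounds.toMS u j c.src * W j c * (B16Sect1Backgrounds.toMS u j c.tgt)⁻¹) (GaugeField.gaugeAct u U₀)) 0
        (fun b => T4AdjointCovarianceUnitary.specialUnitaryAd (u b.tgt) (X b)) i
      = T4AdjointCovarianceUnitary.specialUnitaryAd (B16Sect1Backgrounds.toMS u (((constrEnumB 𝔅 k).symm i).1 : ℕ) ((constrEnumB 𝔅 k).symm i).2.1.tgt)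
          (fderiv ℝ (msChartB F N K k 𝔅 W U₀) 0 X i) := by
  have hsbu : SmallBelow (avOfRecord F N K) k (GaugeField.gaugeAct u U₀) := smallBelow_gaugeAct (P := F.P K) hk u hsb
  have hUu : AgreeOnB 𝔅 (avgFamily (avOfRecord F N K) (GaugeField.gaugeAct u U₀))
      (fun j c => B16Sect1Backgrounds.toMS u j c.src * W j c * (B16Sect1Backgrounds.toMS u j c.tgt)⁻¹) := by
    intro j c hc
    by_cases hj : j ≤ k
    · show Averaging.iter (avOfRecord F N K) j (GaugeField.gaugeAct u U₀) c = _
      rw [B16Sect1Backgrounds.iter_gaugeAct (avOfRecord F N K) u U₀ j (hj.trans hk)]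
      show B16Sect1Backgrounds.toMS u j c.src * Averaging.iter (avOfRecord F N K) j U₀ c * (B16Sect1Backgrounds.toMS u j c.tgt)⁻¹ = _
      rw [show Averaging.iter (avOfRecord F N K) j U₀ c = W j c from hU j c hc]
    · exfalso
      rw [h𝔅 j (lt_of_not_ge hj)] at hc
      simp at hc
  have hj : (((constrEnumB 𝔅 k).symm i).1 : ℕ) ≤ k := Nat.le_of_lt_succ ((constrEnumB 𝔅 k).symm i).1.2
  apply Subtype.ext
  rw [Summit.QuantumFields.YangMills.BalabanUVNodes.N07LinearisedAveragingKernelB.coe_fderiv_msChart_apply_eq_qLin hUu hsbu,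
    T4AdjointCovarianceUnitary.coe_specialUnitaryAd,
    Summit.QuantumFields.YangMills.BalabanUVNodes.N07LinearisedAveragingKernelB.coe_fderiv_msChart_apply_eq_qLin hU hsb,
    qLin_gaugeAct_avOfRecord (hj.trans hk) u (hsb.mono hj) X]

end

end Summit.QuantumFields.YangMills.BalabanUVNodes.N12DirectSurjSharpDelta2B

end
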